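import Mathlib
import Summits.CriticalPhenomena.CardyFormulaZ2.Theorems.CardySelfRefinementDefs
import Summits.CriticalPhenomena.CardyFormulaZ2.Theorems.CardySelfRefinementRussoDriftModel
import Summits.CriticalPhenomena.CardyFormulaZ2.Theorems.CardySelfRefinementGradientComparabilityStubPathPointLower
import Literature.Probability.Percolation.SelfRefinementMeasure
import HarnessLib

/-!
# Crux `GradientComparability` (stmt-CriticalPhenomena-10269), line `monotone-product-coordinates` —
# registered sub-goal `slopeBounds_corner`: the input (CONF) (corner band confinement) from
# hard-way box crossings near the corner

Route `CardySelfRefinement`, sub-problem `CriticalPhenomena/CardyFormulaZ2`; vocabulary from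
`CardySelfRefinementDefs` (`M`, `A`, `P`, `nnSupport`).

The registered reduction `slopeBounds_corner_of_localSlope_of_confinement`
(`…StubSlopeBoundsCorner.lean`) has the hypothesis (CONF): for `k = 2, 3`, a quad family and every
`c₀ > 0` there is `δ > 0` such that `P_η(ρ, c₀) → 1` as `η → 0⁺`, uniformly in `ρ ∈ [1 - 2δ, 1]`.
This file reduces (CONF) to a statement about the law `M_k` ALONE, with no quads:

* **(HWB) hard-way box crossings near the corner**: for every `c₀ > 0` there is `δ > 0` such that
  for every `ε > 0`, at all large integer scales `n`, every translate of the `8n × n` rectangle is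
  crossed the long way horizontally, and every translate of the `n × 8n` rectangle the long way
  vertically, with `M_k(ρ, c₀)`-probability `≥ 1 - ε`, for all `ρ ∈ [1 - 2δ, 1]` — the uniform
  SUPERCRITICALITY of the interior enhancement of the (critical, tied) coarse percolation near
  `ρ = 1` (`c*(ρ) → 0`): an Aizenman–Grimmett essential-enhancement statement plus a supercritical
  finite-size criterion, for `M_k`; not in the tree.

`cornerConfinement_of_hardWayBoxes : (HWB) → (CONF)`: the tubes of `8:1` rectangles of each quad
(`exists_tube_events`, mesh-independent data; one-sided event form `exists_tube_oneSided`) are all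
crossed with probability `≥ (1-ε)^{Σᵢ 2(Nᵢ+1)} ≥ 1 - ε Σᵢ 2(Nᵢ+1)` by Harris–FKG for `M_k`
(`isPositivelyAssociated_M`), and on `nnSupport` this forces every quad to be crossed
(`mem_configOf_iff_exists_isCrossing`, `P_eq_inter_nnSupport`) — the argument of
`stub_pathPoint_lower` with the lower box-crossing constant `1 - ε` in place of `c₀`.
-/

noncomputable section

namespace Summit.CriticalPhenomena.CardyFormulaZ2.Theorems.CardySelfRefinement

open scoped Topology
open Filter Set MeasureTheory
open Literature.Probability.LatticeModels Literature.Probability.Percolation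
open Literature.Probability.Percolation.QuadCrossing
open Summit.CriticalPhenomena.CardyFormulaZ2.Theses.CardySelfRefinement

/-! ## The tube events of a quad, one-sided form -/

-- adapted from `exists_tube_uniform` (…StubPathPointLower.lean): one-sided box bounds
/-- **Tube events of a quad, one-sided uniform form.**  For every quad `Q` there are increasing
measurable events `T η`, an exponent `N` and a size `s > 0` such that: (a) for EVERY positively
associated probability measure `μ` whose long-way crossing probabilities of all translates of the
`8n × n` and `n × 8n` rectangles are `≥ p` (`0 ≤ p`) at all integer scales `n ≥ n₀`, and every
mesh `0 < η < min (s/6) (s/(n₀+1))`, `μ(T η) ≥ (p²)^{N+1}`; (b) for `0 < η < s/6`, on `T η` every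
lattice configuration has, for every shift `t` with `|re t|, |im t| ≤ 2η`, a crossing `K` of `Q`
with `K - t` inside its open edges drawn at mesh `η√2`. -/
theorem exists_tube_oneSided (Q : Quad (univ : Set ℂ)) :
    ∃ (T : ℝ → Set (BondConfig (Site 2))) (N : ℕ) (s : ℝ), 0 < s ∧
      (∀ η, MeasurableSet (T η)) ∧ (∀ η, IsUpperSet (T η)) ∧
      (∀ (μ : Measure (BondConfig (Site 2))) [IsProbabilityMeasure μ], IsPositivelyAssociated μ →
        ∀ (p : ℝ) (n₀ : ℕ), 0 ≤ p →
        (∀ n : ℕ, n₀ ≤ n → ∀ w : ℂ,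
          p ≤ μ.real (embRectCrossing (fun v => squareLatticeEmbedding.z v - w) (8 * n) n) ∧
          p ≤ μ.real (embTBCrossing (fun v => squareLatticeEmbedding.z v - w) n (8 * n))) →
        ∀ η : ℝ, 0 < η → η < s / 6 → η < s / (n₀ + 1) → (p * p) ^ (N + 1) ≤ μ.real (T η)) ∧
      (∀ η : ℝ, 0 < η → η < s / 6 → ∀ t : ℂ, |t.re| ≤ 2 * η → |t.im| ≤ 2 * η →
        ∀ ω ∈ T η, ω ⊆ (zdGraph 2).edgeSet →
          ∃ K, Q.IsCrossing K ∧ ∀ z ∈ K, z - t ∈ openEdgeUnion (η * Real.sqrt 2) ω) := by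
  obtain ⟨N, P, s, hs, hev⟩ := exists_tube_events Q
  set RH : ℝ → ℕ → Set (BondConfig (Site 2)) := fun η j =>
    embRectCrossing (fun v => squareLatticeEmbedding.z v -
      ⟨((P j).re - 3 * s - 2 * η) / η, ((P j).im - s + 2 * η) / η⟩)
      (8 * ⌊s / η⌋₊) ⌊s / η⌋₊ with hRH
  set RV : ℝ → ℕ → Set (BondConfig (Site 2)) := fun η j =>
    embTBCrossing (fun v => squareLatticeEmbedding.z v -
      ⟨((P j).re - s + 2 * η) / η, ((P j).im - 3 * s - 2 * η) / η⟩)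
      ⌊s / η⌋₊ (8 * ⌊s / η⌋₊) with hRV
  have hmeas : ∀ η j, MeasurableSet (RH η j ∩ RV η j) := fun η j =>
    (IsoradialArmExtension.measurableSet_embRectCrossing _ _ _).inter
      (IsoradialArmExtension.measurableSet_embTBCrossing _ _ _)
  have hup : ∀ η j, IsUpperSet (RH η j ∩ RV η j) := fun η j =>
    (isUpperSet_embRectCrossing _ _ _).inter (isUpperSet_embTBCrossing _ _ _)
  -- the integer scale `⌊s/η⌋₊`
  have hscale : ∀ η : ℝ, 0 < η → η < s / 6 →
      6 * η ≤ s ∧ s - η < η * ⌊s / η⌋₊ ∧ η * ⌊s / η⌋₊ ≤ s := by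
    intro η hη0 hη6
    rw [lt_div_iff₀ (by norm_num : (0:ℝ) < 6)] at hη6
    have hfl := Nat.lt_floor_add_one (s / η)
    have hfl' := Nat.floor_le (div_nonneg hs.le hη0.le)
    rw [div_lt_iff₀ hη0] at hfl
    rw [le_div_iff₀ hη0] at hfl'
    exact ⟨by linarith, by linarith, by linarith⟩
  refine ⟨fun η => ⋂ j ∈ Finset.range (N + 1), (RH η j ∩ RV η j), N, s, hs,
    fun η => (Finset.range (N + 1)).measurableSet_biInter fun j _ => hmeas η j,
    fun η => isUpperSet_iInter₂ fun j _ => hup η j, ?_, ?_⟩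
  · intro μ _ hμ p n₀ hp hB η hη0 hη6 hηn
    obtain ⟨-, hn1, -⟩ := hscale η hη0 hη6
    rw [lt_div_iff₀ (by positivity : (0:ℝ) < n₀ + 1)] at hηn
    have hn0 : n₀ ≤ ⌊s / η⌋₊ := by
      have h2 : (n₀ : ℝ) < ⌊s / η⌋₊ := by
        by_contra hcon
        push Not at hcon
        have := mul_le_mul_of_nonneg_left hcon hη0.le
        nlinarith
      exact_mod_cast h2.le
    calc (p * p) ^ (N + 1) = ∏ j ∈ Finset.range (N + 1), p * p := by simp
      _ ≤ ∏ j ∈ Finset.range (N + 1), μ.real (RH η j ∩ RV η j) := by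
          refine Finset.prod_le_prod (fun _ _ => by positivity) fun j _ => ?_
          have h1 := (hB _ hn0 ⟨((P j).re - 3 * s - 2 * η) / η, ((P j).im - s + 2 * η) / η⟩).1
          have h2 := (hB _ hn0 ⟨((P j).re - s + 2 * η) / η, ((P j).im - 3 * s - 2 * η) / η⟩).2
          calc p * p ≤ μ.real (RH η j) * μ.real (RV η j) :=
                mul_le_mul h1 h2 hp measureReal_nonneg
            _ ≤ _ := hμ.real (isUpperSet_embRectCrossing _ _ _) (isUpperSet_embTBCrossing _ _ _)
                (IsoradialArmExtension.measurableSet_embRectCrossing _ _ _)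
                (IsoradialArmExtension.measurableSet_embTBCrossing _ _ _)
      _ ≤ _ := prod_real_le_biInter_of_posAssoc hμ _ (fun j _ => hup η j) fun j _ => hmeas η j
  · intro η hη0 hη6 t htr hti ω hω hωE
    obtain ⟨hηs, hn1, hn2⟩ := hscale η hη0 hη6
    refine hev η hη0 hηs _ hn1 hn2 t htr hti ω hωE fun j hj => ?_
    exact mem_iInter₂.1 hω j (Finset.mem_range.2 (Nat.lt_succ_of_le hj))

/-! ## (CONF) from hard-way box crossings near the corner -/

/-- **Corner band confinement from hard-way box crossings.**  (HWB): for `k = 2, 3` and every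
`c₀ > 0` there is `δ > 0` such that for every `ε > 0`, at all integer scales `n ≥ n₀(ε)`, every
translate of the `8n × n` rectangle is crossed horizontally and every translate of the `n × 8n`
rectangle vertically with `M_k(ρ, c₀)`-probability `≥ 1 - ε`, for all `ρ ∈ [1 - 2δ, 1]`.
Then (CONF): for every quad family and every `v < 1`, `v < P_η(ρ, c₀)` for all small `η` and
all `ρ ∈ [1 - 2δ, 1]`.  Proof: with `E = Σᵢ 2(Nᵢ+1)` (tube exponents of the quads) and
`ε = min ½ ((1-v)/(2(E+1)))`, the tube events have joint probability
`≥ ∏ᵢ ((1-ε)²)^{Nᵢ+1} = (1-ε)^E ≥ 1 - Eε > v` (one-sided tubes `exists_tube_oneSided`, FKG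
`isPositivelyAssociated_M`, Bernoulli's inequality), and on `nnSupport` all tubes crossed forces
all quads crossed (`mem_configOf_iff_exists_isCrossing`, `P_eq_inter_nnSupport`). -/
theorem cornerConfinement_of_hardWayBoxes :
    (∀ k : ℕ, k = 2 ∨ k = 3 → ∀ c₀ : ℝ, 0 < c₀ → ∃ δ : ℝ, 0 < δ ∧ ∀ ε : ℝ, 0 < ε → ∃ n₀ : ℕ,
      ∀ n : ℕ, n₀ ≤ n → ∀ w : ℂ, ∀ ρ ∈ Set.Icc (1 - 2 * δ) 1,
        1 - ε ≤ (M k ρ c₀).real (embRectCrossing (fun v => squareLatticeEmbedding.z v - w) (8 * n) n) ∧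
        1 - ε ≤ (M k ρ c₀).real (embTBCrossing (fun v => squareLatticeEmbedding.z v - w) n (8 * n))) →
    ∀ k : ℕ, k = 2 ∨ k = 3 → ∀ (m : ℕ) (F : Fin m → Quad (Set.univ : Set ℂ)), 0 < m →
      ∀ c₀ : ℝ, 0 < c₀ → ∃ δ : ℝ, 0 < δ ∧ ∀ v : ℝ, v < 1 → ∃ η₁ : ℝ, 0 < η₁ ∧
        ∀ η ∈ Set.Ioo 0 η₁, ∀ ρ ∈ Set.Icc (1 - 2 * δ) 1, v < P k m F η ρ c₀ := by
  intro hHWB k hk m F hm c₀ hc₀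
  obtain ⟨δ, hδ, hbox⟩ := hHWB k hk c₀ hc₀
  refine ⟨δ, hδ, fun v hv => ?_⟩
  choose T N sz hsz hTm hTu hTprob hTcross using fun i => exists_tube_oneSided (F i)
  -- the total tube exponent and the box-crossing defect `ε`
  set E : ℕ := ∑ i, 2 * (N i + 1) with hE
  set ε : ℝ := min (1 / 2) ((1 - v) / (2 * (E + 1))) with hε
  have hv1 : 0 < 1 - v := by linarith
  have hεpos : 0 < ε := lt_min (by norm_num) (by positivity)
  have hε1 : ε ≤ 1 / 2 := min_le_left _ _
  have hεE : (E : ℝ) * ε < 1 - v := by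
    have h1 : (E : ℝ) * ε ≤ E * ((1 - v) / (2 * (E + 1))) :=
      mul_le_mul_of_nonneg_left (min_le_right _ _) (by positivity)
    have h2 : (E : ℝ) * ((1 - v) / (2 * (E + 1))) < 1 - v := by
      rw [mul_div_assoc', div_lt_iff₀ (by positivity)]
      nlinarith
    exact h1.trans_lt h2
  obtain ⟨n₀, hn₀⟩ := hbox ε hεpos
  -- the mesh threshold: a minimum over the nonempty index set
  set f : Fin m → ℝ := fun i => min (sz i / 6) (sz i / (n₀ + 1)) with hf
  obtain ⟨i₀, -, hi₀⟩ :=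
    Finset.exists_min_image Finset.univ f ⟨⟨0, hm⟩, Finset.mem_univ _⟩
  have hf0 : 0 < f i₀ := by
    have := hsz i₀
    simp only [hf]
    positivity
  refine ⟨f i₀, hf0, fun η hη ρ hρ => ?_⟩
  have hη0 : 0 < η := hη.1
  have hηf : ∀ i, η < sz i / 6 ∧ η < sz i / (n₀ + 1) := fun i => by
    have h := hη.2.trans_le (hi₀ i (Finset.mem_univ _))
    exact ⟨h.trans_le (min_le_left _ _), h.trans_le (min_le_right _ _)⟩
  haveI : IsProbabilityMeasure (M k ρ c₀) := isProbabilityMeasure_M k _ _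
  have hN : M k ρ c₀ nnSupportᶜ = 0 := M_compl_nnSupport k _ _
  -- all tubes crossed ⇒ all quads crossed (on the support)
  have hsub : (⋂ i, T i η) ∩ nnSupport ⊆ A m F η ∩ nnSupport := by
    rintro ω ⟨hω, hωN⟩
    refine ⟨fun i => ?_, hωN⟩
    obtain ⟨K, hKQ, hKO⟩ := hTcross i η hη0 (hηf i).1 0 (by simp; positivity)
      (by simp; positivity) ω (mem_iInter.1 hω i) hωN
    exact (mem_configOf_iff_exists_isCrossing hη0 hωN (F i)).2
      ⟨K, hKQ, fun z hz => by simpa using hKO z hz⟩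
  -- the one-sided box bounds at `(ρ, c₀)`
  have hB : ∀ n : ℕ, n₀ ≤ n → ∀ w : ℂ,
      1 - ε ≤ (M k ρ c₀).real (embRectCrossing (fun v => squareLatticeEmbedding.z v - w) (8 * n) n) ∧
      1 - ε ≤ (M k ρ c₀).real (embTBCrossing (fun v => squareLatticeEmbedding.z v - w) n (8 * n)) :=
    fun n hn w => hn₀ n hn w ρ hρ
  -- Bernoulli: `(1 - ε)^E ≥ 1 - E ε > v`
  have hpow : v < ((1 - ε) * (1 - ε)) ^ 0 * ∏ i, ((1 - ε) * (1 - ε)) ^ (N i + 1) := by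
    rw [pow_zero, one_mul]
    have hprod : ∏ i, ((1 - ε) * (1 - ε)) ^ (N i + 1) = (1 - ε) ^ E := by
      rw [hE, ← Finset.prod_pow_eq_pow_sum]
      refine Finset.prod_congr rfl fun i _ => ?_
      rw [← pow_two, ← pow_mul]
    rw [hprod]
    have hbern : 1 + (E : ℝ) * (-ε) ≤ (1 + (-ε)) ^ E :=
      one_add_mul_le_pow (by linarith) E
    have h1 : (1 : ℝ) + -ε = 1 - ε := by ring
    rw [h1] at hbern
    linarith
  rw [pow_zero, one_mul] at hpow
  rw [P_eq_inter_nnSupport]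
  calc v < ∏ i, ((1 - ε) * (1 - ε)) ^ (N i + 1) := hpow
    _ ≤ ∏ i, (M k ρ c₀).real (T i η) :=
        Finset.prod_le_prod (fun i _ => pow_nonneg (mul_self_nonneg _) _) fun i _ =>
          hTprob i (M k ρ c₀) (isPositivelyAssociated_M k _ _) (1 - ε) n₀ (by linarith) hB
            η hη0 (hηf i).1 (hηf i).2
    _ ≤ (M k ρ c₀).real (⋂ i, T i η) :=
        (isPositivelyAssociated_M k _ _).prod_real_le_iInter (fun i => hTu i η) fun i => hTm i η
    _ = (M k ρ c₀).real ((⋂ i, T i η) ∩ nnSupport) := by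
        rw [measureReal_def, measureReal_def, measure_inter_conull hN]
    _ ≤ (M k ρ c₀).real (A m F η ∩ nnSupport) := measureReal_mono hsub

end Summit.CriticalPhenomena.CardyFormulaZ2.Theorems.CardySelfRefinement

end
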